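import Summits.CriticalPhenomena.CardyFormulaZ2.Theorems.CardyBoundaryCoulombGasBoundaryDefectGaussianRStubReferenceLimitPart4
import Literature.Probability.LatticeModels.CollarLegModel
import Literature.Probability.RandomPlanarGeometry.PlanarDomains

/-!
# Stub `stub_referenceLimitV2` of line `rainbow-monomials-in-excursion-kernels` — Part 6:
# the reference square and its CANONICAL configurations, explicitly

Crux `BoundaryDefectGaussianR` (stmt-CriticalPhenomena-14132). Part 4 (`referenceDomain_approximable`)
proved the four non-limit conjuncts of the registered stub for the square `D₀ = (-1, 1)²` with `k` marks
`x_i - i`, `x_i = 2(i+1)/(k+1) - 1`, on its bottom side, INSIDE an existential. The reduction of the stub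
to ONE canonical limit (Part 7, `refV2_of_canonicalLimit : RIGIDITY → CANON → REFV2`) needs the same
facts for the EXPLICIT marked domain and the EXPLICIT canonical configurations
`p_n i = (⌊x_i/δ_n⌋, -⌊1/δ_n⌋₊)` on the lattice boxes `V_n = [-⌊1/δ_n⌋₊, ⌊1/δ_n⌋₊]²`; they are proved
here, by the arguments of Part 4:

* `square_latticeBox` — at mesh `δ` the lattice points of the closed square form the box `[-A, A]²`,
  `A = ⌊1/δ⌋₊`;
* `canonical_admissible` — once `(Σ L + 2) δ ≤ 2/(k+1)` the canonical configuration is injective and the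
  rainbow datum `(L, sink j)` inserted at it is admissible (Part 3, `isAdmissible_of_box`);
  `canonical_eventually` — hence from some index on along every mesh sequence `δ_n → 0⁺`;
* `canonical_tendsto`, `canonical_tendsto_pt` — the canonical points converge to the marked points;
* `refSquare_geometry` — the explicit square is rectilinear, flat at the marks and positively oriented at
  the sink (the three geometric conjuncts of the stub);
* `s12_canonicalConfiguration` (registered sub-goal) — convergence, eventual injectivity and admissibility
  of the canonical configurations on the boxes, in one line.
-/

noncomputable section

namespace Summit.CriticalPhenomena.CardyFormulaZ2.Cruxes.BoundaryDefectGaussianR.RainbowMonomialsInExcursionKernels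

open Filter Topology Set
open Literature.Probability.RandomPlanarGeometry Literature.Probability.LatticeModels
  Literature.Probability.LatticeModels.CollarLegModel

/-! ### The lattice boxes of the reference square and the canonical configurations -/

/-- At mesh `δ > 0` the lattice points of the closed square `[-1, 1]²` form the box `[-A, A]²`,
`A = ⌊1/δ⌋₊`. [folklore] -/
theorem square_latticeBox {δ : ℝ} (hδ : 0 < δ) {V : Finset (ℤ × ℤ)}
    (hV : ∀ v : ℤ × ℤ, v ∈ V ↔
      ((v.1 : ℂ) * ((δ : ℝ) : ℂ) + (v.2 : ℂ) * ((δ : ℝ) : ℂ) * Complex.I) ∈ closure (symRect 1 1)) :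
    ∀ v : ℤ × ℤ, v ∈ V ↔ (-(⌊1 / δ⌋₊ : ℤ) ≤ v.1 ∧ v.1 ≤ ⌊1 / δ⌋₊) ∧
      (-(⌊1 / δ⌋₊ : ℤ) ≤ v.2 ∧ v.2 ≤ ⌊1 / δ⌋₊) := by
  have hAℤ : ((⌊1 / δ⌋₊ : ℕ) : ℤ) = ⌊1 / δ⌋ := Int.natCast_floor_eq_floor (one_div_nonneg.2 hδ.le)
  have key : ∀ z : ℤ, (-1 ≤ (z : ℝ) * δ ∧ (z : ℝ) * δ ≤ 1) ↔ (-(⌊1 / δ⌋₊ : ℤ) ≤ z ∧ z ≤ ⌊1 / δ⌋₊) := by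
    intro z
    rw [hAℤ, Int.le_floor, le_div_iff₀ hδ]
    refine and_congr ⟨fun h ↦ ?_, fun h ↦ ?_⟩ Iff.rfl
    · have h' : ((-z : ℤ) : ℝ) ≤ 1 / δ := by rw [le_div_iff₀ hδ]; push_cast; linarith
      have := Int.le_floor.2 h'
      omega
    · have h' : (-z : ℤ) ≤ ⌊1 / δ⌋ := by omega
      have := Int.le_floor.1 h'
      rw [le_div_iff₀ hδ] at this
      push_cast at this
      linarith
  intro v
  rw [hV v, mem_closure_symRect one_pos one_pos]
  have hre : ((v.1 : ℂ) * ((δ : ℝ) : ℂ) + (v.2 : ℂ) * ((δ : ℝ) : ℂ) * Complex.I).re = v.1 * δ := by simp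
  have him : ((v.1 : ℂ) * ((δ : ℝ) : ℂ) + (v.2 : ℂ) * ((δ : ℝ) : ℂ) * Complex.I).im = v.2 * δ := by simp
  rw [hre, him]
  exact and_congr (key v.1) (key v.2)

/-- **The canonical configuration is injective and admissible on the box.** At a mesh `δ` with
`(Σ_i L_i + 2) δ ≤ 2/(k+1)`, the rounded marks `p i = (⌊x_i/δ⌋, -⌊1/δ⌋₊)`, `x_i = 2(i+1)/(k+1) - 1`, are
pairwise at least `Σ L + 1` columns apart and off the corners of the bottom row of the box
`[-⌊1/δ⌋₊, ⌊1/δ⌋₊]²`, so `p` is injective and the rainbow datum `(L, sink j)` inserted at `p` is admissible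
(Part 3, `isAdmissible_of_box`), for every family with a source and positive source leg numbers. [folklore] -/
theorem canonical_admissible (k : ℕ) (L : Fin k → ℕ) (j : Fin k) (hk : ∃ i, i ≠ j)
    (hpos : ∀ i, i ≠ j → 1 ≤ L i) {δ : ℝ} (hδ : 0 < δ)
    (hsmall : ((∑ i, L i : ℕ) : ℝ) + 2 ≤ 2 / ((k : ℝ) + 1) / δ) {V : Finset (ℤ × ℤ)}
    (hV : ∀ v : ℤ × ℤ, v ∈ V ↔ (-(⌊1 / δ⌋₊ : ℤ) ≤ v.1 ∧ v.1 ≤ ⌊1 / δ⌋₊) ∧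
      (-(⌊1 / δ⌋₊ : ℤ) ≤ v.2 ∧ v.2 ≤ ⌊1 / δ⌋₊))
    {p : Fin k → ℤ × ℤ} (hp : ∀ i, p i = (⌊(2 * ((i : ℝ) + 1) / (k + 1) - 1) / δ⌋, -(⌊1 / δ⌋₊ : ℤ))) :
    Function.Injective p ∧ (⟨(Finset.univ.erase j).image p,
      fun v ↦ ∑ b ∈ (Finset.univ.erase j).filter (fun b ↦ p b = v), L b, p j⟩ :
      LegInsertionData).IsAdmissible V := by
  classical
  set g : ℝ := 2 / ((k : ℝ) + 1) with hgdef
  set G : ℕ := (∑ i, L i) + 1 with hGdef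
  have hk0 : (0 : ℝ) < k + 1 := by positivity
  have hG1 : (1 : ℝ) ≤ G := by rw [hGdef]; push_cast; linarith [(Finset.univ.sum_nonneg fun i _ ↦ (L i).cast_nonneg : (0 : ℝ) ≤ ∑ i, (L i : ℝ))]
  have hkey : (G : ℝ) + 1 ≤ g / δ := by rw [hGdef]; push_cast at hsmall ⊢; linarith
  have hg2 : g ≤ 2 := div_le_self (by norm_num) (by linarith)
  -- the abscissae of the marks
  have hxs : ∀ i : Fin k, -1 + g ≤ 2 * ((i : ℝ) + 1) / (k + 1) - 1 ∧ 2 * ((i : ℝ) + 1) / (k + 1) - 1 ≤ 1 - g :=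
    square_mark_re_bounds k
  have hxgap : ∀ i i' : Fin k, i < i' →
      g ≤ (2 * ((i' : ℝ) + 1) / (k + 1) - 1) - (2 * ((i : ℝ) + 1) / (k + 1) - 1) := fun i i' h ↦ by
    have : (i : ℝ) + 1 ≤ i' := by exact_mod_cast h
    rw [hgdef, show (2 * ((i' : ℝ) + 1) / (k + 1) - 1) - (2 * ((i : ℝ) + 1) / (k + 1) - 1) =
      2 * ((i' : ℝ) - i) / (k + 1) by ring]
    exact div_le_div_of_nonneg_right (by linarith) hk0.le
  -- separation, and distance to the corners, of the rounded marks
  have hsepℤ : ∀ i i' : Fin k, i < i' →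
      (G : ℤ) ≤ ⌊(2 * ((i' : ℝ) + 1) / (k + 1) - 1) / δ⌋ - ⌊(2 * ((i : ℝ) + 1) / (k + 1) - 1) / δ⌋ :=
    fun i i' h ↦ floor_sub_floor_ge hδ (hxgap i i' h) hkey
  have hright : ∀ i : Fin k, ⌊(2 * ((i : ℝ) + 1) / (k + 1) - 1) / δ⌋ < (⌊1 / δ⌋₊ : ℤ) :=
    fun i ↦ floor_lt_natFloor hδ (hxs i).2 (by linarith)
  have hleft : ∀ i : Fin k, -(⌊1 / δ⌋₊ : ℤ) < ⌊(2 * ((i : ℝ) + 1) / (k + 1) - 1) / δ⌋ :=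
    fun i ↦ neg_natFloor_lt_floor hδ (hxs i).1 (by linarith)
  have hinj : Function.Injective p := by
    intro i i' h
    rw [hp, hp] at h
    have h1 := (Prod.ext_iff.1 h).1
    simp only at h1
    by_contra hne
    rcases lt_or_gt_of_ne hne with hlt | hlt
    · have := hsepℤ i i' hlt; omega
    · have := hsepℤ i' i hlt; omega
  refine ⟨hinj, ?_⟩
  -- admissibility: Part 3 on the box `[-A, A]²`, `A = ⌊1/δ⌋₊`
  set A : ℕ := ⌊1 / δ⌋₊ with hA
  have hA1 : 1 ≤ A := by
    rw [hA, Nat.one_le_floor_iff, le_div_iff₀ hδ, one_mul]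
    have : 2 ≤ g / δ := by linarith
    rw [le_div_iff₀ hδ] at this
    linarith
  have hbox : ∀ v : ℤ × ℤ, v ∈ V ↔ (-(A : ℤ) ≤ v.1 ∧ v.1 ≤ -(A : ℤ) + ((2 * A : ℕ) : ℤ)) ∧
      (-(A : ℤ) ≤ v.2 ∧ v.2 ≤ -(A : ℤ) + ((2 * A : ℕ) : ℤ)) := by
    intro v
    rw [hV v, show (-(A : ℤ) + ((2 * A : ℕ) : ℤ)) = (A : ℤ) by push_cast; ring]
  have hmem : ∀ x ∈ insert (p j) ((Finset.univ.erase j).image p), ∃ i, x = p i :=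
    fun x hx ↦ rainbow_mem_insert j p hx
  refine isAdmissible_of_box hbox (by omega) _ (G := G) (rainbow_source_nonempty j p hk)
    (rainbow_legs_pos L j p hpos) (rainbow_sink_not_mem j p hinj)
    ((rainbow_sinkLegs_le L j p).trans (Nat.le_succ _)) ?_ ?_
  · intro x hx
    obtain ⟨i, rfl⟩ := hmem x hx
    rw [hp]
    have h1 := hleft i
    have h2 := hright i
    refine ⟨rfl, h1, ?_⟩
    push_cast; omega
  · intro x hx x' hx' hne
    obtain ⟨i, rfl⟩ := hmem x hx
    obtain ⟨i', rfl⟩ := hmem x' hx'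
    have hii : i ≠ i' := fun h ↦ hne (h ▸ rfl)
    rw [hp, hp]
    simp only
    rcases lt_or_gt_of_ne hii with hlt | hlt
    · have := hsepℤ i i' hlt
      rw [abs_sub_comm]; exact le_abs.2 (Or.inl this)
    · have := hsepℤ i' i hlt
      exact le_abs.2 (Or.inl this)

/-- Along a mesh sequence `δ_n → 0⁺`, the canonical configurations are injective and admissible on the
boxes `V_n = [-⌊1/δ_n⌋₊, ⌊1/δ_n⌋₊]²` from some index on. [folklore] -/
theorem canonical_eventually (k : ℕ) (L : Fin k → ℕ) (j : Fin k) (hk : ∃ i, i ≠ j)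
    (hpos : ∀ i, i ≠ j → 1 ≤ L i) {δ : ℕ → ℝ} (hδ : ∀ n, 0 < δ n) (hδ0 : Tendsto δ atTop (𝓝 0))
    {V : ℕ → Finset (ℤ × ℤ)} (hV : ∀ n, ∀ v : ℤ × ℤ, v ∈ V n ↔ (-(⌊1 / δ n⌋₊ : ℤ) ≤ v.1 ∧ v.1 ≤ ⌊1 / δ n⌋₊) ∧
      (-(⌊1 / δ n⌋₊ : ℤ) ≤ v.2 ∧ v.2 ≤ ⌊1 / δ n⌋₊)) {p : ℕ → Fin k → ℤ × ℤ}
    (hp : ∀ n i, p n i = (⌊(2 * ((i : ℝ) + 1) / (k + 1) - 1) / δ n⌋, -(⌊1 / δ n⌋₊ : ℤ))) :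
    ∃ N : ℕ, ∀ n, N ≤ n → Function.Injective (p n) ∧ (⟨(Finset.univ.erase j).image (p n),
      fun v ↦ ∑ b ∈ (Finset.univ.erase j).filter (fun b ↦ (p n) b = v), L b, (p n) j⟩ :
      LegInsertionData).IsAdmissible (V n) := by
  have hc : (0 : ℝ) < 2 / ((k : ℝ) + 1) / (((∑ i, L i : ℕ) : ℝ) + 2) := by positivity
  obtain ⟨N, hN⟩ : ∃ N, ∀ n ≥ N, δ n < 2 / ((k : ℝ) + 1) / (((∑ i, L i : ℕ) : ℝ) + 2) :=
    eventually_atTop.1 (hδ0.eventually (gt_mem_nhds hc))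
  refine ⟨N, fun n hn ↦ canonical_admissible k L j hk hpos (hδ n) ?_ (hV n) (hp n)⟩
  rw [le_div_iff₀ (hδ n)]
  have := hN n hn
  rw [lt_div_iff₀ (by positivity)] at this
  linarith

/-- Along a mesh sequence `δ_n → 0⁺`, the `i`-th canonical point converges to the `i`-th marked point
`x_i - i` of the reference square. [folklore] -/
theorem canonical_tendsto (k : ℕ) {δ : ℕ → ℝ} (hδ : ∀ n, 0 < δ n) (hδ0 : Tendsto δ atTop (𝓝 0))
    {p : ℕ → Fin k → ℤ × ℤ}
    (hp : ∀ n i, p n i = (⌊(2 * ((i : ℝ) + 1) / (k + 1) - 1) / δ n⌋, -(⌊1 / δ n⌋₊ : ℤ))) (i : Fin k) :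
    Tendsto (fun n ↦ (((p n i).1 : ℂ) * ((δ n : ℝ) : ℂ) + ((p n i).2 : ℂ) * ((δ n : ℝ) : ℂ) * Complex.I))
      atTop (𝓝 (⟨2 * ((i : ℝ) + 1) / (k + 1) - 1, -1⟩ : ℂ)) := by
  have hlim : Tendsto (fun n ↦ (((⌊(2 * ((i : ℝ) + 1) / (k + 1) - 1) / δ n⌋ : ℝ) * δ n : ℝ) : ℂ) +
      ((-((⌊1 / δ n⌋₊ : ℝ) * δ n) : ℝ) : ℂ) * Complex.I) atTop
      (𝓝 (⟨2 * ((i : ℝ) + 1) / (k + 1) - 1, -1⟩ : ℂ)) := by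
    rw [Complex.mk_eq_add_mul_I]
    refine ((Complex.continuous_ofReal.tendsto _).comp (tendsto_floor_mul _ hδ hδ0)).add
      (((Complex.continuous_ofReal.tendsto _).comp ?_).mul tendsto_const_nhds)
    simpa using (tendsto_natFloor_mul hδ hδ0).neg
  refine hlim.congr fun n ↦ ?_
  rw [hp n i]
  push_cast
  ring

/-- The same convergence, to the `i`-th marked point `D₀.pt i` of the explicit reference square. [folklore] -/
theorem canonical_tendsto_pt (k : ℕ) (D₀ : MarkedDomain k)
    (hD : D₀ = ⟨rectDomain 1 1 one_pos one_pos, fun i ↦ ((i : ℝ) + 1) / (4 * (k + 1)),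
      square_mark_strictMono k, square_mark_mem k⟩)
    {δ : ℕ → ℝ} (hδ : ∀ n, 0 < δ n) (hδ0 : Tendsto δ atTop (𝓝 0)) {p : ℕ → Fin k → ℤ × ℤ}
    (hp : ∀ n i, p n i = (⌊(2 * ((i : ℝ) + 1) / (k + 1) - 1) / δ n⌋, -(⌊1 / δ n⌋₊ : ℤ))) (i : Fin k) :
    Tendsto (fun n ↦ (((p n i).1 : ℂ) * ((δ n : ℝ) : ℂ) + ((p n i).2 : ℂ) * ((δ n : ℝ) : ℂ) * Complex.I))
      atTop (𝓝 (D₀.pt i)) := by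
  have hpt : D₀.pt i = ⟨2 * ((i : ℝ) + 1) / (k + 1) - 1, -1⟩ := by rw [hD]; exact polygonLoop_square_mark k i
  rw [hpt]
  exact canonical_tendsto k hδ hδ0 hp i

/-! ### The reference square: rectilinear, flat at the marks, positively oriented at the sink -/

/-- **Geometry of the reference square** `(-1, 1)²` with the `k` marks `x_i - i` on its bottom side
(the marked domain of Part 4, `referenceDomain_approximable`): its frontier lies on four axis-parallel
segments, it is horizontal near every mark, and at the sink mark `j` the boundary leaves in direction
`τ = 1` with the interior on the left (`+i` side). [folklore] -/
theorem refSquare_geometry (k : ℕ) (j : Fin k) (D₀ : MarkedDomain k)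
    (hD : D₀ = ⟨rectDomain 1 1 one_pos one_pos, fun i ↦ ((i : ℝ) + 1) / (4 * (k + 1)),
      square_mark_strictMono k, square_mark_mem k⟩) :
    (∃ S : Finset (ℂ × ℂ), (∀ q ∈ S, q.1.re = q.2.re ∨ q.1.im = q.2.im) ∧
      frontier D₀.carrier ⊆ ⋃ q ∈ S, segment ℝ q.1 q.2) ∧
    (∀ i, (∃ r : ℝ, 0 < r ∧ ((∀ z ∈ frontier D₀.carrier, dist z (D₀.pt i) < r → z.im = (D₀.pt i).im) ∨
      (∀ z ∈ frontier D₀.carrier, dist z (D₀.pt i) < r → z.re = (D₀.pt i).re)))) ∧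
    (∃ τ : ℂ, ‖τ‖ = 1 ∧ (∃ ε : ℝ, 0 < ε ∧ ∀ t ∈ Set.Ioo (D₀.mark j) (D₀.mark j + ε), ∃ s : ℝ, 0 < s ∧
      D₀.boundary t = D₀.pt j + (s : ℂ) * τ) ∧ (∃ ε : ℝ, 0 < ε ∧ ∀ s ∈ Set.Ioo (0 : ℝ) ε,
      D₀.pt j + (s : ℂ) * (τ * Complex.I) ∈ D₀.carrier)) := by
  subst hD
  set D₀ : MarkedDomain k := ⟨rectDomain 1 1 one_pos one_pos, fun i ↦ ((i : ℝ) + 1) / (4 * (k + 1)),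
    square_mark_strictMono k, square_mark_mem k⟩ with hD₀
  have hcar : D₀.carrier = symRect 1 1 := rfl
  have hbd : ∀ t, D₀.boundary t = polygonLoop (rectVerts 1 1) t := fun t ↦ rfl
  have hmark : ∀ i, D₀.mark i = ((i : ℝ) + 1) / (4 * (k + 1)) := fun i ↦ rfl
  have hpt : ∀ i, D₀.pt i = ⟨2 * ((i : ℝ) + 1) / (k + 1) - 1, -1⟩ := fun i ↦ polygonLoop_square_mark k i
  have hk0 : (0 : ℝ) < k + 1 := by positivity
  refine ⟨⟨_, square_sides_axisParallel, hcar ▸ frontier_square_subset⟩, ?_, ?_⟩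
  · -- FLAT MARKS: the frontier is horizontal near each mark
    intro i
    obtain ⟨hlo, hhi⟩ := square_mark_re_bounds k i
    have hg : (0 : ℝ) < 2 / ((k : ℝ) + 1) := by positivity
    refine ⟨min (1 - (2 * ((i : ℝ) + 1) / (k + 1) - 1)) (1 + (2 * ((i : ℝ) + 1) / (k + 1) - 1)),
      lt_min (by linarith) (by linarith), Or.inl fun z hz hd ↦ ?_⟩
    rw [hpt] at hd ⊢
    exact frontier_square_flat_bottom (hcar ▸ hz) hd
  · -- ORIENTED AT THE SINK: the bottom side runs in direction `τ = 1`, the interior is above it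
    refine ⟨1, by simp, ⟨1 / (4 * ((k : ℝ) + 1)), by positivity, fun t ht ↦ ?_⟩, ⟨1, one_pos, fun s hs ↦ ?_⟩⟩
    · rw [hmark] at ht
      obtain ⟨ht1, ht2⟩ := ht
      have hj : (j : ℝ) + 1 ≤ k := by exact_mod_cast j.2
      have ht0 : 0 ≤ t := le_trans (by positivity) ht1.le
      have ht4 : t ≤ 1 / 4 := by
        have : ((j : ℝ) + 1) / (4 * (k + 1)) + 1 / (4 * (k + 1)) ≤ 1 / 4 := by
          rw [← add_div, div_le_iff₀ (by positivity)]; linarith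
        linarith
      refine ⟨8 * (t - ((j : ℝ) + 1) / (4 * (k + 1))), by linarith, ?_⟩
      rw [hbd, polygonLoop_square_bottom ht0 ht4, hpt]
      generalize hs₀ : (8 * (t - ((j : ℝ) + 1) / (4 * (k + 1))) : ℝ) = s₀
      apply Complex.ext
      · simp only [Complex.add_re, Complex.ofReal_re, mul_one]
        rw [← hs₀]
        field_simp
        ring
      · simp only [Complex.add_im, Complex.mul_im, Complex.ofReal_re, Complex.one_im, Complex.ofReal_im,
          Complex.one_re, mul_zero, zero_mul, add_zero]
    · rw [hpt, hcar]
      obtain ⟨hlo, hhi⟩ := square_mark_re_bounds k j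
      have hg : (0 : ℝ) < 2 / ((k : ℝ) + 1) := by positivity
      obtain ⟨hs0, hs1⟩ := hs
      have e : (⟨2 * ((j : ℝ) + 1) / (k + 1) - 1, -1⟩ : ℂ) + (s : ℂ) * (1 * Complex.I) =
          ⟨2 * ((j : ℝ) + 1) / (k + 1) - 1, -1 + s⟩ := by
        apply Complex.ext <;> simp
      rw [e, mem_symRect]
      exact ⟨⟨by linarith, by linarith⟩, by linarith, by linarith⟩

/-- **Registered sub-goal `s12_canonicalConfiguration`** of `stub_referenceLimitV2` (stmt-CriticalPhenomena-14132):
along every mesh sequence `δ_n → 0⁺`, the canonical configurations `p_n i = (⌊x_i/δ_n⌋, -⌊1/δ_n⌋₊)` on the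
lattice boxes `[-⌊1/δ_n⌋₊, ⌊1/δ_n⌋₊]²` converge (rescaled) to the marks `x_i - i` of the reference square and
are injective and admissible from some index on — the canonical data consumed by the reduction
`RIGIDITY → CANON → REFV2` of Part 7 (`canonical_tendsto`, `canonical_eventually`). [folklore] -/
theorem s12_canonicalConfiguration : ∀ (k : ℕ) (L : Fin k → ℕ) (j : Fin k), (∃ i, i ≠ j) → (∀ i, i ≠ j → 1 ≤ L i) → ∀ (δ : ℕ → ℝ), (∀ n, 0 < δ n) → Filter.Tendsto δ Filter.atTop (nhds 0) → ∀ (V : ℕ → Finset (ℤ × ℤ)), (∀ n, ∀ v : ℤ × ℤ, v ∈ V n ↔ (-(⌊1 / δ n⌋₊ : ℤ) ≤ v.1 ∧ v.1 ≤ ⌊1 / δ n⌋₊) ∧ (-(⌊1 / δ n⌋₊ : ℤ) ≤ v.2 ∧ v.2 ≤ ⌊1 / δ n⌋₊)) → ∀ (p : ℕ → Fin k → ℤ × ℤ), (∀ n i, p n i = (⌊(2 * ((i : ℝ) + 1) / (k + 1) - 1) / δ n⌋, -(⌊1 / δ n⌋₊ : ℤ))) → (∀ i, Filter.Tendsto (fun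 n ↦ (((p n i).1 : ℂ) * ((δ n : ℝ) : ℂ) + ((p n i).2 : ℂ) * ((δ n : ℝ) : ℂ) * Complex.I)) Filter.atTop (nhds (⟨2 * ((i : ℝ) + 1) / (k + 1) - 1, -1⟩ : ℂ))) ∧ ∃ N : ℕ, ∀ n, N ≤ n → Function.Injective (p n) ∧ Literature.Probability.LatticeModels.CollarLegModel.LegInsertionData.IsAdmissible (⟨(Finset.univ.erase j).image (p n), fun v ↦ ∑ b ∈ (Finset.univ.erase j).filter (fun b ↦ (p n) b = v), L b, (p n) j⟩ : Literature.Probability.LatticeModels.CollarLegModel.LegInsertionData) (V n) :=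
  fun k L j hk hpos _δ hδ hδ0 _V hV _p hp ↦
    ⟨fun i ↦ canonical_tendsto k hδ hδ0 hp i, canonical_eventually k L j hk hpos hδ hδ0 hV hp⟩

end Summit.CriticalPhenomena.CardyFormulaZ2.Cruxes.BoundaryDefectGaussianR.RainbowMonomialsInExcursionKernels

end
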